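import Summits.ABC.ABC.Theorems.IneffectiveSubspaceDepthCountedABCStubCellZeroQuarticThue
import Summits.ABC.ABC.Theorems.IneffectiveSubspaceDepthCountedABCStubQuarticThueOfCellZero

/-!
# Stub `stub_cellZeroIffUniformQuarticThueCell` of line `Sketch` — crux `DepthCountedABC` (stmt-ABC-14938)

WHAT.  On the 5-free cell `#{p : v_p(abc) ≥ 5} = 0` of crux #5 `DepthCountedABC` the first improvement of
the free exponent `2` is EXACTLY the uniform binomial quartic Thue statement RESTRICTED TO THE CELL:
`(∃ δ > 0, ∃ C > 0, ∀ 5-free abc triples, c < C·rad(abc)^(2−δ)) ↔ (∃ η > 0, ∃ B, ∀ a u v Y Z > 0,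
a + uY⁴ = vZ⁴ → gcd(uY⁴, vZ⁴) = 1 → (a, uY⁴, vZ⁴) 5-free → a·u·v ≤ Z^η → Z ≤ B)`.
Lead c19 landed the two halves asymmetrically (Stub 13 `stub_cellZeroOfUniformQuarticThue` assumes the
UNRESTRICTED Thue statement, Stub 14 `stub_uniformQuarticThueOfCellZero` produces only the cell-restricted
one); this certificate closes the pair into an exact equivalence.

MECHANISM.  `→`: Stub 14 at `η = δ/2` (`5·(δ/2) < 4δ`).  `←` (`cellZeroIffUQTCell_of_cell`): the proof
of Stub 13 verbatim — order the triple `a ≤ b`, write `b = uY⁴`, `c = vZ⁴` (`quarticThue_natBounds`, with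
`a·u·v·c⁸ ≤ 16·rad¹⁶`, `c⁷ ≤ 8·rad¹²·Z⁴`, `c < 2·rad²`); with `δ = min(η,1)/64`, on an exceptional triple
`c ≥ rad^(2−δ)` either `a·u·v ≤ Z^η`, where the Thue hypothesis is applied to the datum `(a, u, v, Y, Z)`
— whose 5-freeness hypothesis is LITERALLY the cell hypothesis of the triple once `b = uY⁴`, `c = vZ⁴`
are substituted — giving `Z ≤ B` and `rad ≤ 8B⁴`; or `Z^η < a·u·v ≤ 16·rad^(8δ)` while `Z⁴ ≥ rad/8`,
giving `rad^(η/8) < 16·8^(η/4)`; either way `rad`, hence `c < 2·rad²`, is bounded, and ordinary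
triples satisfy `c < rad^(2−δ)` outright.

Sources: skeleton `Cruxes/DepthCountedABC/Lines/Sketch.lean` (lead c23, wave 3), stub
`stub_cellZeroIffUniformQuarticThueCell`.  Ingredients (all landed and sorry-free, namespace
`Summit.ABC.ABC.Theorems.DepthCountedABC`): `stub_uniformQuarticThueOfCellZero`
(`Theorems/IneffectiveSubspaceDepthCountedABCStubQuarticThueOfCellZero.lean`), `quarticThue_natBounds`
(`Theorems/IneffectiveSubspaceDepthCountedABCStubCellZeroQuarticThue.lean`),
`calibration_fiveFree_of_card_eq_zero` (`Theorems/IneffectiveSubspaceDepthCountedABCStubCalibration.lean`),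
and Mathlib (`Nat.radical_pos`, `Real.one_le_rpow`, `Real.rpow_add`, `Real.rpow_mul`, `Real.rpow_natCast`,
`Real.rpow_le_rpow`, `Real.rpow_lt_rpow`, `Real.rpow_le_rpow_of_exponent_le`, `Real.div_rpow`).  No unproved
facts.  Deliberately NOT here: the cell-1 analogue (`stub_cellOneIffUniformQuarticThueMahlerCell`, another
certificate) and anything at exponent `1 + ε`.
-/

-- `Summit.<Summit>.<Problem>` is the mandated summit-side namespace (CONVENTIONS §2); for the
-- single-conjunct summit `ABC` the two coincide, so the duplicate `ABC.ABC` is deliberate.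
set_option linter.dupNamespace false

namespace Summit.ABC.ABC.Theorems.DepthCountedABC

open UniqueFactorizationMonoid (radical) in
open Literature.NumberTheory.DiophantineGeometry (IsABCTriple rad rad_def) in
/-- **The `←` half of `stub_cellZeroIffUniformQuarticThueCell`:** if for some `η > 0` the positive coprime
solutions of `a + u·Y⁴ = v·Z⁴` WITH 5-FREE TRIPLE `(a, uY⁴, vZ⁴)` and `a·u·v ≤ Z^η` have bounded `Z`
(uniform binomial quartic Thue on the cell), then abc holds on the 5-free cell with SOME exponent
`2 − δ < 2` (`δ = min(η,1)/64`): `c < C·rad(abc)^(2−δ)`.  The proof of `stub_cellZeroOfUniformQuarticThue`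
verbatim, the hypothesis being applied only to the datum read off a 5-free triple. [folklore] -/
theorem cellZeroIffUQTCell_of_cell : ∀ η : ℝ, 0 < η →
    (∃ B : ℕ, ∀ a u v Y Z : ℕ, 0 < a → 0 < u → 0 < v → 0 < Y → 0 < Z →
        a + u * Y ^ 4 = v * Z ^ 4 → Nat.Coprime (u * Y ^ 4) (v * Z ^ 4) →
        ((a * (u * Y ^ 4) * (v * Z ^ 4)).primeFactors.filter
            (fun p => 5 ≤ (a * (u * Y ^ 4) * (v * Z ^ 4)).factorization p)).card = 0 →
        ((a * u * v : ℕ) : ℝ) ≤ (Z : ℝ) ^ η → Z ≤ B) →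
    ∃ δ : ℝ, 0 < δ ∧ ∃ C : ℝ, 0 < C ∧ ∀ a b c : ℕ,
      Literature.NumberTheory.DiophantineGeometry.IsABCTriple a b c →
      ((a * b * c).primeFactors.filter (fun p => 5 ≤ (a * b * c).factorization p)).card = 0 →
      (c : ℝ) < C * ((Literature.NumberTheory.DiophantineGeometry.rad a b c : ℕ) : ℝ) ^ (2 - δ) := by
  intro η hη hT
  obtain ⟨B, hB⟩ := hT
  -- parameters
  set η' : ℝ := min η 1 with hη'
  have hη'pos : 0 < η' := lt_min hη one_pos
  have hη'le : η' ≤ η := min_le_left _ _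
  have hη'le1 : η' ≤ 1 := min_le_right _ _
  set δ : ℝ := η' / 64 with hδ
  have hδpos : 0 < δ := by positivity
  have hδle : δ ≤ 1 / 64 := by rw [hδ]; linarith
  set K : ℝ := 16 * (8 : ℝ) ^ (η' / 4) with hK
  have hKpos : 0 < K := by positivity
  set R₀ : ℝ := max (8 * (B : ℝ) ^ 4) (K ^ (8 / η')) + 1 with hR₀
  have hR₀pos : 0 < R₀ := by
    have : (0 : ℝ) ≤ max (8 * (B : ℝ) ^ 4) (K ^ (8 / η')) :=
      le_trans (by positivity) (le_max_left _ _)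
    linarith
  refine ⟨δ, hδpos, 2 * R₀ ^ 2 + 1, by positivity, ?_⟩
  intro a b c habc h0
  -- WLOG `a ≤ b` (all three data are symmetric in `a, b`)
  wlog hab : a ≤ b generalizing a b with H
  · have hsw : IsABCTriple b a c :=
      ⟨habc.2.1, habc.1, by rw [add_comm]; exact habc.2.2.1, habc.2.2.2.symm⟩
    have hprod : b * a * c = a * b * c := by ring
    have h0' : ((b * a * c).primeFactors.filter (fun p => 5 ≤ (b * a * c).factorization p)).card = 0 := by
      rw [hprod]; exact h0
    have := H b a hsw h0' (le_of_not_ge hab)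
    rwa [rad_def, hprod, ← rad_def] at this
  -- the ordered case
  have h4 : ∀ p ∈ (a * b * c).primeFactors, (a * b * c).factorization p ≤ 4 :=
    calibration_fiveFree_of_card_eq_zero h0
  obtain ⟨u, v, Y, Z, hbuY, hcvZ, hu, hv, hY, hZ, hF5, hF6, hc2⟩ := quarticThue_natBounds habc hab h4
  obtain ⟨ha, hb, hsum, hcop⟩ := habc
  set R := rad a b c with hR
  have hR1nat : 1 ≤ R := by rw [hR, rad_def]; exact Nat.radical_pos _
  have hx1 : (1 : ℝ) ≤ (R : ℝ) := by exact_mod_cast hR1nat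
  have hx0 : (0 : ℝ) < (R : ℝ) := by linarith
  have hδ2 : (0 : ℝ) ≤ 2 - δ := by linarith
  have hpow1 : (1 : ℝ) ≤ (R : ℝ) ^ (2 - δ) := Real.one_le_rpow hx1 hδ2
  have hc2R : (c : ℝ) < 2 * (R : ℝ) ^ 2 := by exact_mod_cast hc2
  by_cases hexc : (R : ℝ) ^ (2 - δ) ≤ (c : ℝ)
  · -- exceptional triple: `rad` is bounded by `R₀`
    have hcpos : (0 : ℝ) < (c : ℝ) := by exact_mod_cast (show 0 < c by omega)
    have hZ1 : (1 : ℝ) ≤ (Z : ℝ) := by exact_mod_cast hZ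
    have hZ0 : (0 : ℝ) ≤ (Z : ℝ) := by positivity
    -- real forms of F5, F6
    have hF5R : ((a * u * v : ℕ) : ℝ) * (c : ℝ) ^ 8 ≤ 16 * (R : ℝ) ^ 16 := by exact_mod_cast hF5
    have hF6R : (c : ℝ) ^ 7 ≤ 8 * (R : ℝ) ^ 12 * (Z : ℝ) ^ 4 := by exact_mod_cast hF6
    -- powers of the exceptional inequality
    have hexc7 : (R : ℝ) ^ ((2 - δ) * 7) ≤ (c : ℝ) ^ 7 := by
      rw [Real.rpow_mul hx0.le, Real.rpow_ofNat]
      exact pow_le_pow_left₀ (Real.rpow_nonneg hx0.le _) hexc 7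
    have hexc8 : (R : ℝ) ^ ((2 - δ) * 8) ≤ (c : ℝ) ^ 8 := by
      rw [Real.rpow_mul hx0.le, Real.rpow_ofNat]
      exact pow_le_pow_left₀ (Real.rpow_nonneg hx0.le _) hexc 8
    have hxR₀ : (R : ℝ) < R₀ := by
      by_cases hA : ((a * u * v : ℕ) : ℝ) ≤ (Z : ℝ) ^ η'
      · -- Case A: the Thue hypothesis bounds `Z`, and `c⁷ ≤ 8R¹²Z⁴` with `c ≥ R^(2−δ)` bounds `R`
        have hZη : ((a * u * v : ℕ) : ℝ) ≤ (Z : ℝ) ^ η :=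
          hA.trans (Real.rpow_le_rpow_of_exponent_le hZ1 hη'le)
        have heq : a + u * Y ^ 4 = v * Z ^ 4 := by rw [← hbuY, ← hcvZ, hsum]
        have hcopr : Nat.Coprime (u * Y ^ 4) (v * Z ^ 4) := by
          rw [← hbuY, ← hcvZ, ← hsum, add_comm, Nat.coprime_self_add_right]; exact hcop.symm
        -- the 5-freeness hypothesis of the datum is the cell hypothesis of the triple
        have h0' : ((a * (u * Y ^ 4) * (v * Z ^ 4)).primeFactors.filter
            (fun p => 5 ≤ (a * (u * Y ^ 4) * (v * Z ^ 4)).factorization p)).card = 0 := by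
          rw [← hbuY, ← hcvZ]; exact h0
        have hZB : Z ≤ B := hB a u v Y Z ha hu hv hY hZ heq hcopr h0' hZη
        have hZBR : (Z : ℝ) ^ 4 ≤ (B : ℝ) ^ 4 := by
          exact_mod_cast Nat.pow_le_pow_left hZB 4
        have h13 : (R : ℝ) ^ (13 : ℝ) ≤ (R : ℝ) ^ ((2 - δ) * 7) :=
          Real.rpow_le_rpow_of_exponent_le hx1 (by linarith)
        have hchain : (R : ℝ) ^ (13 : ℕ) ≤ 8 * (B : ℝ) ^ 4 * (R : ℝ) ^ (12 : ℕ) := by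
          have h1 : (R : ℝ) ^ (13 : ℕ) ≤ (c : ℝ) ^ 7 := by
            rw [← Real.rpow_natCast]
            push_cast
            exact h13.trans hexc7
          calc (R : ℝ) ^ (13 : ℕ) ≤ (c : ℝ) ^ 7 := h1
            _ ≤ 8 * (R : ℝ) ^ 12 * (Z : ℝ) ^ 4 := hF6R
            _ ≤ 8 * (R : ℝ) ^ 12 * (B : ℝ) ^ 4 := by gcongr
            _ = 8 * (B : ℝ) ^ 4 * (R : ℝ) ^ (12 : ℕ) := by ring
        have hx12 : (0 : ℝ) < (R : ℝ) ^ (12 : ℕ) := by positivity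
        have hxle : (R : ℝ) ≤ 8 * (B : ℝ) ^ 4 := by
          have : (R : ℝ) * (R : ℝ) ^ (12 : ℕ) ≤ (8 * (B : ℝ) ^ 4) * (R : ℝ) ^ (12 : ℕ) := by
            calc (R : ℝ) * (R : ℝ) ^ (12 : ℕ) = (R : ℝ) ^ (13 : ℕ) := by ring
              _ ≤ _ := hchain
          exact le_of_mul_le_mul_right this hx12
        calc (R : ℝ) ≤ 8 * (B : ℝ) ^ 4 := hxle
          _ ≤ max (8 * (B : ℝ) ^ 4) (K ^ (8 / η')) := le_max_left _ _
          _ < R₀ := by rw [hR₀]; linarith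
      · -- Case B: `Z^η' < a·u·v ≤ 16 R^(8δ)` while `Z⁴ ≥ R/8`, so `R^(η'/8) < K`
        push Not at hA
        -- upper bound for `a u v`
        have hc8pos : (0 : ℝ) < (c : ℝ) ^ 8 := by positivity
        have hauv : ((a * u * v : ℕ) : ℝ) ≤ 16 * (R : ℝ) ^ (8 * δ) := by
          have h1 : ((a * u * v : ℕ) : ℝ) ≤ 16 * (R : ℝ) ^ 16 / (c : ℝ) ^ 8 := by
            rw [le_div_iff₀ hc8pos]; exact hF5R
          have h2 : 16 * (R : ℝ) ^ 16 / (c : ℝ) ^ 8 ≤ 16 * (R : ℝ) ^ 16 / (R : ℝ) ^ ((2 - δ) * 8) :=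
            div_le_div_of_nonneg_left (by positivity) (Real.rpow_pos_of_pos hx0 _) hexc8
          have h3 : 16 * (R : ℝ) ^ 16 / (R : ℝ) ^ ((2 - δ) * 8) = 16 * (R : ℝ) ^ (8 * δ) := by
            have : (R : ℝ) ^ (16 : ℕ) = (R : ℝ) ^ ((2 - δ) * 8) * (R : ℝ) ^ (8 * δ) := by
              rw [← Real.rpow_add hx0]
              have he : (2 - δ) * 8 + 8 * δ = ((16 : ℕ) : ℝ) := by push_cast; ring
              rw [he, Real.rpow_natCast]
            rw [this]
            have hne : (R : ℝ) ^ ((2 - δ) * 8) ≠ 0 := (Real.rpow_pos_of_pos hx0 _).ne'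
            field_simp
          linarith [h1, h2, h3.le]
        -- lower bound for `Z ^ 4`
        have hZ4 : (R : ℝ) / 8 ≤ (Z : ℝ) ^ 4 := by
          have h1 : (R : ℝ) ^ (1 : ℝ) ≤ (R : ℝ) ^ ((2 - δ) * 7 - 12) :=
            Real.rpow_le_rpow_of_exponent_le hx1 (by linarith)
          have h2 : (R : ℝ) ^ ((2 - δ) * 7 - 12) * (R : ℝ) ^ (12 : ℝ) = (R : ℝ) ^ ((2 - δ) * 7) := by
            rw [← Real.rpow_add hx0]; ring_nf
          have h3 : (R : ℝ) * (R : ℝ) ^ (12 : ℕ) ≤ 8 * (R : ℝ) ^ 12 * (Z : ℝ) ^ 4 := by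
            calc (R : ℝ) * (R : ℝ) ^ (12 : ℕ) = (R : ℝ) ^ (1 : ℝ) * (R : ℝ) ^ (12 : ℝ) := by
                  rw [Real.rpow_one, ← Real.rpow_natCast]; norm_num
              _ ≤ (R : ℝ) ^ ((2 - δ) * 7 - 12) * (R : ℝ) ^ (12 : ℝ) := by
                  gcongr
              _ = (R : ℝ) ^ ((2 - δ) * 7) := h2
              _ ≤ (c : ℝ) ^ 7 := hexc7
              _ ≤ 8 * (R : ℝ) ^ 12 * (Z : ℝ) ^ 4 := hF6R
          have hx12 : (0 : ℝ) < (R : ℝ) ^ (12 : ℕ) := by positivity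
          have : (R : ℝ) ≤ 8 * (Z : ℝ) ^ 4 := by
            have h4' : (R : ℝ) * (R : ℝ) ^ (12 : ℕ) ≤ (8 * (Z : ℝ) ^ 4) * (R : ℝ) ^ (12 : ℕ) := by
              calc _ ≤ 8 * (R : ℝ) ^ 12 * (Z : ℝ) ^ 4 := h3
                _ = (8 * (Z : ℝ) ^ 4) * (R : ℝ) ^ (12 : ℕ) := by ring
            exact le_of_mul_le_mul_right h4' hx12
          linarith
        -- pass to the exponent `η'/4`
        have hZη' : ((R : ℝ) / 8) ^ (η' / 4) ≤ (Z : ℝ) ^ η' := by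
          have h1 : ((R : ℝ) / 8) ^ (η' / 4) ≤ ((Z : ℝ) ^ 4) ^ (η' / 4) :=
            Real.rpow_le_rpow (by positivity) hZ4 (by positivity)
          have h2 : ((Z : ℝ) ^ 4) ^ (η' / 4) = (Z : ℝ) ^ η' := by
            rw [← Real.rpow_natCast, ← Real.rpow_mul hZ0]
            congr 1
            push_cast
            ring
          rw [← h2]; exact h1
        have hsplitR : ((R : ℝ) / 8) ^ (η' / 4) = (R : ℝ) ^ (η' / 8) * (R : ℝ) ^ (η' / 8) / (8 : ℝ) ^ (η' / 4) := by
          rw [Real.div_rpow hx0.le (by norm_num), ← Real.rpow_add hx0]; ring_nf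
        have h8δ : 8 * δ = η' / 8 := by rw [hδ]; ring
        have hkey : (R : ℝ) ^ (η' / 8) * (R : ℝ) ^ (η' / 8) < K * (R : ℝ) ^ (η' / 8) := by
          have h88 : (0 : ℝ) < (8 : ℝ) ^ (η' / 4) := by positivity
          have h1 : (R : ℝ) ^ (η' / 8) * (R : ℝ) ^ (η' / 8) / (8 : ℝ) ^ (η' / 4) < 16 * (R : ℝ) ^ (η' / 8) := by
            calc _ = ((R : ℝ) / 8) ^ (η' / 4) := hsplitR.symm
              _ ≤ (Z : ℝ) ^ η' := hZη'
              _ < ((a * u * v : ℕ) : ℝ) := hA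
              _ ≤ 16 * (R : ℝ) ^ (8 * δ) := hauv
              _ = 16 * (R : ℝ) ^ (η' / 8) := by rw [h8δ]
          rw [div_lt_iff₀ h88] at h1
          calc _ < 16 * (R : ℝ) ^ (η' / 8) * (8 : ℝ) ^ (η' / 4) := h1
            _ = K * (R : ℝ) ^ (η' / 8) := by rw [hK]; ring
        have hRη : (R : ℝ) ^ (η' / 8) < K :=
          lt_of_mul_lt_mul_right hkey (Real.rpow_nonneg hx0.le _)
        have hRK : (R : ℝ) < K ^ (8 / η') := by
          have h1 : ((R : ℝ) ^ (η' / 8)) ^ (8 / η') < K ^ (8 / η') :=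
            Real.rpow_lt_rpow (Real.rpow_nonneg hx0.le _) hRη (by positivity)
          have h2 : ((R : ℝ) ^ (η' / 8)) ^ (8 / η') = (R : ℝ) := by
            rw [← Real.rpow_mul hx0.le]
            have : η' / 8 * (8 / η') = 1 := by field_simp
            rw [this, Real.rpow_one]
          rw [h2] at h1; exact h1
        calc (R : ℝ) < K ^ (8 / η') := hRK
          _ ≤ max (8 * (B : ℝ) ^ 4) (K ^ (8 / η')) := le_max_right _ _
          _ < R₀ := by rw [hR₀]; linarith
    -- conclude on the exceptional triple
    have hR₀sq : (R : ℝ) ^ 2 < R₀ ^ 2 := by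
      have : (0 : ℝ) ≤ (R : ℝ) := hx0.le
      nlinarith
    calc (c : ℝ) < 2 * (R : ℝ) ^ 2 := hc2R
      _ ≤ 2 * R₀ ^ 2 + 1 := by linarith
      _ = (2 * R₀ ^ 2 + 1) * 1 := (mul_one _).symm
      _ ≤ (2 * R₀ ^ 2 + 1) * (R : ℝ) ^ (2 - δ) := by
          apply mul_le_mul_of_nonneg_left hpow1; positivity
  · -- ordinary triple: `c < R^(2−δ) ≤ C·R^(2−δ)`
    push Not at hexc
    calc (c : ℝ) < (R : ℝ) ^ (2 - δ) := hexc
      _ = 1 * (R : ℝ) ^ (2 - δ) := (one_mul _).symm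
      _ ≤ (2 * R₀ ^ 2 + 1) * (R : ℝ) ^ (2 - δ) := by
          apply mul_le_mul_of_nonneg_right _ (by positivity)
          nlinarith [sq_nonneg R₀]

/-- **Stub `stub_cellZeroIffUniformQuarticThueCell` (Stub 28, c23 wave 3) of line `Sketch`, crux
`DepthCountedABC` (stmt-ABC-14938):** on the 5-free cell, abc with SOME exponent `2 − δ < 2` is EQUIVALENT to
the uniform binomial quartic Thue statement on the cell — for some `η > 0` the positive coprime solutions of
`a + u·Y⁴ = v·Z⁴` with 5-free `a·(uY⁴)·(vZ⁴)` and `a·u·v ≤ Z^η` have bounded `Z`.  `→` is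
`stub_uniformQuarticThueOfCellZero` at `η = δ/2`, `←` is `cellZeroIffUQTCell_of_cell`. [folklore] -/
theorem stub_cellZeroIffUniformQuarticThueCell :
    (∃ δ : ℝ, 0 < δ ∧ ∃ C : ℝ, 0 < C ∧ ∀ a b c : ℕ,
      Literature.NumberTheory.DiophantineGeometry.IsABCTriple a b c →
      ((a * b * c).primeFactors.filter (fun p => 5 ≤ (a * b * c).factorization p)).card = 0 →
      (c : ℝ) < C * ((Literature.NumberTheory.DiophantineGeometry.rad a b c : ℕ) : ℝ) ^ (2 - δ)) ↔
    (∃ η : ℝ, 0 < η ∧ ∃ B : ℕ, ∀ a u v Y Z : ℕ, 0 < a → 0 < u → 0 < v → 0 < Y → 0 < Z →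
      a + u * Y ^ 4 = v * Z ^ 4 → Nat.Coprime (u * Y ^ 4) (v * Z ^ 4) →
      ((a * (u * Y ^ 4) * (v * Z ^ 4)).primeFactors.filter
          (fun p => 5 ≤ (a * (u * Y ^ 4) * (v * Z ^ 4)).factorization p)).card = 0 →
      ((a * u * v : ℕ) : ℝ) ≤ (Z : ℝ) ^ η → Z ≤ B) := by
  constructor
  · rintro ⟨δ, hδ, C, hC, h⟩
    exact ⟨δ / 2, by positivity,
      stub_uniformQuarticThueOfCellZero δ hδ ⟨C, hC, h⟩ (δ / 2) (by positivity) (by linarith)⟩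
  · rintro ⟨η, hη, B, hB⟩
    exact cellZeroIffUQTCell_of_cell η hη ⟨B, hB⟩

end Summit.ABC.ABC.Theorems.DepthCountedABC
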